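import Summits.CriticalPhenomena.PercolationContinuityZ3.Theorems.Transplant.SkelFrmBChoiceNums
import HarnessLib

/-!
# N2 (frames-only node `SamePDropOfSkeletonFrm₁`, OPEN) — (F) column, DISCHARGE LAYER, block **F-K1 (part 1): THE KIT / APRON / COUNT ROWS OF THE FACE KEYSTONE
# `Skelφ.faceOblRM_of_kits9TC` AT THE (S0) KIT OF RECORD `KS0.kit0`** (hp-8 g42 named this block for the p1 lineage BY CLAIM, lane INBOX 2026-08-23T10:59:50Z;
# lead g12 11:06:40Z: route-SIGN-FREE, hence outside the J23 hold).

Every row below is a closed arithmetic fact about `KS0.kit0 t D mk A r₀ := ⟨13, ℓsa, M0, d, 0, 1, 0, A, r₀⟩` (SkelFrmBChoiceNums) and the (S0) levels/counts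
`KS0.j₀0/j₁0/Rlev0/R'0/kk0/Nk0/rs0/cS0`, stated in the EXACT binder shapes of the keystone (HOME/prim-hp-8/code/gen42/T/SkelPhiFaceHoldsKits9TC.lean :72–:232,
group numbers of F-DISCHARGE-MAP-N2.md):
* §1 **G17 + G5 (face kit `PA := KS0.kit0 t D mk A r₀`, any `A r₀`)**: `faceKit_rows` (`hPN : 3 ≤ N`, `hdD`, `hDρ`, `hKCmax : (shellD + nz + 1)·3 ≤ KCmax` at `nz := Mu D`,
  `hT'`), `faceKit_A` (`hA`, rfl), `faceKit_sizes` (`hrs`, `hcS` at `rs := rs0`, `cS := cS0`, `cU := cUA`), `faceKit_r₀` (`hr₀` from `base0 ≤ r₀`), `faceKit_reach`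
  (`hreach` from `r + reach0 ≤ r₀`), **`faceKit_rooms`** = N1's `faceApron_rooms_T` at the (S0) kit: `hMtan`, `hMd`, `hMD`, `hE` with **`M := j₀0 − 1`**,
  **`Rlev := Rlev0`, `E := Rlev0 + reach0`** (hp-8's band of record, HypsF `bandF_facts`), and **`counts_face_0`** = N1's `counts_face_T`: `hN`, `hk`, `hcount` at
  `kk := kk0`, `N := Nk0`, accuracy `κ.δ₂`, levels `Icc ((j₀0 − 1) + 1) Rlev0 ⊇ Icc j₀0 j₁0`.
* §2 **G11 (bridge kit `Pb := KS0.kit0 t D mk ((Mu D : ℤ) + 2) r₀`)**: `bridgeKit_rows` (`hPNb : 1 ≤ N`, `hAb` (rfl), `hdDb`, `hDρb`, `hKCmaxb : shellD + Mz + 1 ≤ KCmaxb`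
  at `Mz := Mu D`, `KCmaxb := KS.KCmax`, `hT'b`); `hrsb/hcSb` = `faceKit_sizes`, `hr₀b/hreachb` = `faceKit_r₀/faceKit_reach`; and `kit_hE` (`hEb`'s arithmetic:
  `j₁0 + (N·(tanOff+1) + N·d + KCmax) ≤ R′` for every frame radius `R′ ≥ R'0 = Rlev0 + 1`).
* §3 **G12 (run kit `Pr := KS0.kit0 t D mk (((Mu D + 1 : ℕ) : ℤ)·U + 1) r₀`, any `U`, shear constant `kq ≤ 10`)**: `runKit_rows` (`hPNr : kq + 3 ≤ N`, `hAr` (rfl), `hdDr`,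
  `hDρr`, `hKCmaxr : (shellD + Mz + 1)·(kq+1) ≤ KCmax`, `hT'r`); sizes/r₀/reach as above; `hEr`/`hEy` = `kit_hE` at `R's = R'₃ := R'0`.
  (The run-box WIDTH rows `hwider…/hwideyY…` (F-K2) and the run kit's ROLE depend on the J23 ruling (R-44) — not in this part.)
* §4 **G8/G15 levels and counts of the three inner kits** (all = the (S0) kit): `levels_0` (`hRl : Rlev0 + 1 ≤ R'0`, `hj : j₁0 ≤ Rlev0`, `j₀0 ≤ j₁0`),
  `counts_root_0` (`hkN := hNk0_at`, `hk/hcount := counts_atq_root` at `δ := κ.δr 0`) and `counts_kit_0 (hδ' : δkit ≤ δ')` (any accuracy, e.g. `Neg.δkit`).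
* §5 **G13 (short region)**: `region_rows` bundles `KS.RgK_subset_graphBall`, `card_RgK_le`, `hcU1_at` in the keystone's `hRg/hRgcard/hcU1` shape.
What this part does NOT contain (stays with the assembler or waits): the slot floors on `r`/`L'` (`hRb₀ : Pb.r₀ ≤ r`, `hRr₀`, `hr₁R`, `hr₂R`, `hRsr`, `hρr`,
`hr₀L : PA.r₀ + 1 ≤ 2L'`, `hR₁b/hR₁r : R₁k ≤ r − P.r₀` — one-line `omega`s once `r₀ := KS0.r₀0 …` and the `ex`-floor are fixed by the packager), the G6 face-FRAME
rows over the T cells (part 2, after (R-44)), and every route/bridge/link/zone row (J23 hold).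
NON-VACUITY: no hypothesis beyond `kq ≤ 10`, `base0 ≤ r₀` / `r + reach0 ≤ r₀` (satisfied by `r₀ := KS0.r₀0 t D mk r`, `KS0.r₀0_ge`), `0 < p < 1`, `p/2 ≤ q ≤ p`, `δkit ≤ δ′`.
builds on p205010 (kernel theorem, internal audit signed; external expert review pending) — nothing in this file uses p205010; NOTHING is claimed about the open node
`SamePDropOfSkeletonFrm₁`; arithmetic only.
Lane `prim-bschramm`, seat `prim-bschramm-p1` (gen 18); helper file (`--supports stmt-CriticalPhenomena-4575 --as helper`). Pattern = N1 `SkelNegBParamsFaceRoomsA` §Kit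
(`counts_face_T`, `faceApron_rooms_T`, stmt/hp-8) and `SkelPhiFaceNegBTC1` (hp-8 g36) read against `KS0`.
[cite: KozmaNitzan2024, §4 Lemma 10 Steps II–IV (pp. 18–21); Lemma 12 (pp. 23–25)] [cite: MartineauTassion2017, §4.3]
-/

noncomputable section

open scoped Classical

namespace Summit.CriticalPhenomena.PercolationContinuityZ3.Theorems.Transplant

namespace PlanarSkeletonFrm

namespace NegB

namespace KS0

open Literature.Probability.Percolation Literature.Probability.LatticeModels SimpleGraph
open Literature.Barriers.CriticalPhenomena (graphBall)
open SkelConc (Consts)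
open SkelI (tanOff)
open Skelφ.StepI (DataN)
open Neg

section FaceKit

variable {V : Type} (t : V) (D : Skelφ.StepI.DataNS V) (mk : ℕ)

/-- **G17 — the face kit's constant rows** for `PA := KS0.kit0 t D mk A r₀` (any `A r₀`): `hPN : 3 ≤ N` (`N = 13`), `hdD : d + 2 ≤ shellD`, `hDρ : Rs + 1 ≤ shellD`,
`hKCmax : (shellD + nz + 1)·3 ≤ KCmax` at `nz := Mu D`, `hT' : shellD + KCmax + Rs ≤ tanOff ℓs M` (`KS0.kit0_ok` at `kq := 2`). [folklore] -/
theorem faceKit_rows (A : ℤ) (r₀ : ℕ) :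
    3 ≤ (kit0 t D mk A r₀).N ∧
      (kit0 t D mk A r₀).d + 2 ≤ Skelφ.shellD (kit0 t D mk A r₀) ∧
      KS.Rs t D mk + 1 ≤ Skelφ.shellD (kit0 t D mk A r₀) ∧
      (Skelφ.shellD (kit0 t D mk A r₀) + Mu D + 1) * 3 ≤ KS.KCmax t D mk ∧
      (Skelφ.shellD (kit0 t D mk A r₀) : ℤ) + KS.KCmax t D mk + KS.Rs t D mk ≤ tanOff (kit0 t D mk A r₀).ℓs (kit0 t D mk A r₀).M := by
  obtain ⟨hN, hd, hρ, hK, hT, -⟩ := kit0_ok t D mk A r₀ (kq := 2) (by norm_num)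
  exact ⟨by omega, hd, hρ, hK, hT⟩

/-- **G17 — `hA`**: the face kit's shear field is what it is built with (`rfl`): `(kit0 t D mk (((nz + 1 : ℕ) : ℤ) * Dp + 1) r₀).A = ((nz + 1 : ℕ) : ℤ) * Dp + 1`. [folklore] -/
theorem faceKit_A (nz : ℕ) (Dp : ℤ) (r₀ : ℕ) : (kit0 t D mk (((nz + 1 : ℕ) : ℤ) * Dp + 1) r₀).A = ((nz + 1 : ℕ) : ℤ) * Dp + 1 := rfl

/-- **G17/G11/G12 — the size rows** `hrs : 1 + (N·(tanOff+2) + N·d + (KCmax+Rs)) ≤ rs0`, `hcS : (N+1)·(tanOff+1) + (N+1)·d + (KCmax+1) + cU ≤ cS0` (`KS0.kit0_sizes`). [folklore] -/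
theorem faceKit_sizes {G : SimpleGraph V} [G.LocallyFinite] (Φ : PlanarSkeletonFrm G) (A : ℤ) (r₀ : ℕ) :
    1 + ((kit0 t D mk A r₀).N * (tanOff (kit0 t D mk A r₀).ℓs (kit0 t D mk A r₀).M + 2) + (kit0 t D mk A r₀).N * (kit0 t D mk A r₀).d +
        (KS.KCmax t D mk + KS.Rs t D mk)) ≤ rs0 t D mk ∧
    ((kit0 t D mk A r₀).N + 1) * (tanOff (kit0 t D mk A r₀).ℓs (kit0 t D mk A r₀).M + 1) + ((kit0 t D mk A r₀).N + 1) * (kit0 t D mk A r₀).d +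
        (KS.KCmax t D mk + 1) + KS.cUA Φ t D mk ≤ cS0 Φ t D mk :=
  kit0_sizes Φ t D mk A r₀

/-- **G17/G11/G12 — `hr₀` and `1 ≤ r₀`** for any threshold `r₀ ≥ base0` (in particular `r₀ := KS0.r₀0 t D mk Rl`, `KS0.r₀0_ge`). [folklore] -/
theorem faceKit_r₀ (A : ℤ) {r₀ : ℕ} (h : base0 t D mk ≤ r₀) :
    (kit0 t D mk A r₀).N * (tanOff (kit0 t D mk A r₀).ℓs (kit0 t D mk A r₀).M + 2) + (kit0 t D mk A r₀).N * (kit0 t D mk A r₀).d +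
        (KS.KCmax t D mk + KS.Rs t D mk) ≤ (kit0 t D mk A r₀).r₀ ∧ 1 ≤ (kit0 t D mk A r₀).r₀ :=
  hr₀_kit0 t D mk A h

/-- **G17/G11/G12 — `hreach`/`hreachb`/`hreachr`**: `r + (N·(tanOff+1) + N·d + KCmax) ≤ r₀` for any `r₀ ≥ r + reach0`. [folklore] -/
theorem faceKit_reach (A : ℤ) {r r₀ : ℕ} (h : r + reach0 t D mk ≤ r₀) :
    r + ((kit0 t D mk A r₀).N * (tanOff (kit0 t D mk A r₀).ℓs (kit0 t D mk A r₀).M + 1) + (kit0 t D mk A r₀).N * (kit0 t D mk A r₀).d + KS.KCmax t D mk) ≤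
      (kit0 t D mk A r₀).r₀ :=
  hreach_kit0 t D mk A h

/-- The (S0) kit's reach IS `reach0`: `N·(tanOff+1) + N·d + KCmax = reach0` (`N = 13`, `tanOff = T0`). [folklore] -/
theorem kit0_reach_eq (A : ℤ) (r₀ : ℕ) :
    (kit0 t D mk A r₀).N * (tanOff (kit0 t D mk A r₀).ℓs (kit0 t D mk A r₀).M + 1) + (kit0 t D mk A r₀).N * (kit0 t D mk A r₀).d + KS.KCmax t D mk =
      reach0 t D mk := by
  rw [tanOff_kit0]; simp only [kit0]; unfold reach0; ring

/-- **G5 — THE FACE KIT'S ROOMS** (N1 `faceApron_rooms_T` at the (S0) kit, any `A r₀`) with `M := j₀0 − 1`, `Rlev := Rlev0`, `E := Rlev0 + reach0`: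
`hMtan : tanOff ℓs M ≤ (j₀0 − 1) + 1`, `hMd : d + 2 ≤ 2·(j₀0 − 1) + 2`, `hMD : shellD + 1 + d + KCmax + Rs ≤ 2·(j₀0 − 1) + 2`,
`hE : Rlev0 + (N·(tanOff+1) + N·d + KCmax) ≤ Rlev0 + reach0` (`tanOff = T0 = j₀0 ≥ 1`, `KS0.levels_wide` at `j₀0`). [folklore] -/
theorem faceKit_rooms (κ : Consts) [DecidableEq V] [Countable V] {G : SimpleGraph V} [G.LocallyFinite] (Φ : PlanarSkeletonFrm G) (p : unitInterval) (A : ℤ) (r₀ : ℕ) :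
    tanOff (kit0 t D mk A r₀).ℓs (kit0 t D mk A r₀).M ≤ ((j₀0 t D mk - 1 : ℕ) : ℤ) + 1 ∧
      (kit0 t D mk A r₀).d + 2 ≤ 2 * (j₀0 t D mk - 1) + 2 ∧
      Skelφ.shellD (kit0 t D mk A r₀) + 1 + (kit0 t D mk A r₀).d + KS.KCmax t D mk + KS.Rs t D mk ≤ 2 * (j₀0 t D mk - 1) + 2 ∧
      Rlev0 κ Φ t p D mk + ((kit0 t D mk A r₀).N * (tanOff (kit0 t D mk A r₀).ℓs (kit0 t D mk A r₀).M + 1) +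
          (kit0 t D mk A r₀).N * (kit0 t D mk A r₀).d + KS.KCmax t D mk) ≤ Rlev0 κ Φ t p D mk + reach0 t D mk := by
  have hw := levels_wide t D mk (le_refl (j₀0 t D mk))
  have hT := T0_eq' t D mk
  have hD2 := KS.hD2_at t D mk
  rw [kit0_reach_eq, tanOff_kit0, shellD_kit0]
  simp only [kit0]
  unfold j₀0 at *
  refine ⟨?_, by omega, by omega, le_rfl⟩
  have h1 : 1 ≤ T0 t D mk := by omega
  rw [Nat.cast_sub h1]; push_cast; omega

/-- **G5/G17 — THE FACE KIT'S COUNTS AT ACCURACY `κ.δ₂`** (N1 `counts_face_T` at the (S0) kit): `hN : kk0·(Δ+1)^{2·rs0} ≤ Nk0`,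
`hk : (1 − q^{1+Δ·cS0+cS0·cU})^{kk0} ≤ δ₂`, `hcount : 1/(1−q)^{Δ·Nk0} ≤ δ₂·card (Icc ((j₀0 − 1) + 1) Rlev0)` (`⊇ Icc j₀0 j₁0`, `KS0.counts_atq_face`). [folklore] -/
theorem counts_face_0 (κ : Consts) [DecidableEq V] [Countable V] {G : SimpleGraph V} [G.LocallyFinite] (Φ : PlanarSkeletonFrm G) (p : unitInterval)
    (hp0 : 0 < (p : ℝ)) (hp1 : (p : ℝ) < 1) {q : unitInterval} (hq1 : (p : ℝ) / 2 ≤ q) (hq2 : (q : ℝ) ≤ p) :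
    kk0 κ Φ t p D mk * (Φ.Δ + 1) ^ (2 * rs0 t D mk) ≤ Nk0 κ Φ t p D mk ∧
      (1 - (q : ℝ) ^ (1 + Φ.Δ * cS0 Φ t D mk + cS0 Φ t D mk * KS.cUA Φ t D mk)) ^ kk0 κ Φ t p D mk ≤ κ.δ₂ ∧
      1 / (1 - (q : ℝ)) ^ (Φ.Δ * Nk0 κ Φ t p D mk) ≤ κ.δ₂ * ((Finset.Icc ((j₀0 t D mk - 1) + 1) (Rlev0 κ Φ t p D mk)).card : ℝ) := by
  obtain ⟨hk, hc⟩ := counts_atq_face κ Φ t p D mk hp0 hp1 hq1 hq2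
  refine ⟨hNk0_at κ Φ t p D mk hp0 hp1, hk, hc.trans (mul_le_mul_of_nonneg_left ?_ κ.hδ₂0.le)⟩
  have h1 : 1 ≤ j₀0 t D mk := by have := T0_eq' t D mk; have := KS.hD2_at t D mk; unfold j₀0; omega
  have hsub : Finset.Icc (j₀0 t D mk) (j₁0 κ Φ t p D mk) ⊆ Finset.Icc ((j₀0 t D mk - 1) + 1) (Rlev0 κ Φ t p D mk) :=
    Finset.Icc_subset_Icc (by omega) (R'0_eq κ Φ t p D mk).2.2
  exact_mod_cast Finset.card_le_card hsub

end FaceKit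

section BridgeKit

variable {V : Type} (t : V) (D : Skelφ.StepI.DataNS V) (mk : ℕ)

/-- **G11 — the bridge kit's constant rows** for `Pb := KS0.kit0 t D mk ((Mu D : ℤ) + 2) r₀`: `hPNb : 1 ≤ N`, `hAb : A = Mz + 2` at `Mz := Mu D`, `hdDb`, `hDρb`,
`hKCmaxb : shellD + Mz + 1 ≤ KCmaxb` at `KCmaxb := KS.KCmax`, `hT'b` (`KS0.kit0_ok` at `kq := 0`). [folklore] -/
theorem bridgeKit_rows (r₀ : ℕ) :
    1 ≤ (kit0 t D mk (((Mu D : ℕ) : ℤ) + 2) r₀).N ∧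
      (kit0 t D mk (((Mu D : ℕ) : ℤ) + 2) r₀).A = ((Mu D : ℕ) : ℤ) + 2 ∧
      (kit0 t D mk (((Mu D : ℕ) : ℤ) + 2) r₀).d + 2 ≤ Skelφ.shellD (kit0 t D mk (((Mu D : ℕ) : ℤ) + 2) r₀) ∧
      KS.Rs t D mk + 1 ≤ Skelφ.shellD (kit0 t D mk (((Mu D : ℕ) : ℤ) + 2) r₀) ∧
      Skelφ.shellD (kit0 t D mk (((Mu D : ℕ) : ℤ) + 2) r₀) + Mu D + 1 ≤ KS.KCmax t D mk ∧
      (Skelφ.shellD (kit0 t D mk (((Mu D : ℕ) : ℤ) + 2) r₀) : ℤ) + KS.KCmax t D mk + KS.Rs t D mk ≤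
        tanOff (kit0 t D mk (((Mu D : ℕ) : ℤ) + 2) r₀).ℓs (kit0 t D mk (((Mu D : ℕ) : ℤ) + 2) r₀).M := by
  obtain ⟨-, hd, hρ, hK, hT, hN1⟩ := kit0_ok t D mk (((Mu D : ℕ) : ℤ) + 2) r₀ (kq := 0) (by norm_num)
  exact ⟨hN1, rfl, hd, hρ, by simpa using hK, hT⟩

/-- **G11/G12 — `hEb`/`hEr`/`hEy` arithmetic**: the top inner-kit level plus the kit's reach fits under every frame radius `R′ ≥ R'0`:
`j₁0 + (N·(tanOff+1) + N·d + KCmax) ≤ R′` (`j₁0 + reach0 = Rlev0 < R'0 ≤ R′`; bridge frames have `R′ := R'0` by hp-8's `BF_R'_ge`, run frames `R's = R'₃ := R'0`). [folklore] -/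
theorem kit_hE (κ : Consts) [DecidableEq V] [Countable V] {G : SimpleGraph V} [G.LocallyFinite] (Φ : PlanarSkeletonFrm G) (p : unitInterval) (A : ℤ) (r₀ : ℕ)
    {R' : ℕ} (hR' : R'0 κ Φ t p D mk ≤ R') :
    j₁0 κ Φ t p D mk + ((kit0 t D mk A r₀).N * (tanOff (kit0 t D mk A r₀).ℓs (kit0 t D mk A r₀).M + 1) + (kit0 t D mk A r₀).N * (kit0 t D mk A r₀).d +
        KS.KCmax t D mk) ≤ R' := by
  rw [kit0_reach_eq]
  have h := (R'0_eq κ Φ t p D mk).1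
  omega

end BridgeKit

section RunKit

variable {V : Type} (t : V) (D : Skelφ.StepI.DataNS V) (mk : ℕ)

/-- **G12 — the run kit's constant rows** for `Pr := KS0.kit0 t D mk (((Mu D + 1 : ℕ) : ℤ) * U + 1) r₀` (any across period `U`, shear constant `kq ≤ 10`):
`hPNr : kq + 3 ≤ N`, `hAr : A = (Mz + 1)·U + 1` at `Mz := Mu D`, `hdDr`, `hDρr`, `hKCmaxr : (shellD + Mz + 1)·(kq + 1) ≤ KCmaxr` at `KCmaxr := KS.KCmax`, `hT'r`
(`KS0.kit0_ok`). [folklore] -/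
theorem runKit_rows (U : ℤ) (r₀ : ℕ) {kq : ℕ} (hkq : kq ≤ 10) :
    kq + 3 ≤ (kit0 t D mk (((Mu D + 1 : ℕ) : ℤ) * U + 1) r₀).N ∧
      (kit0 t D mk (((Mu D + 1 : ℕ) : ℤ) * U + 1) r₀).A = ((Mu D + 1 : ℕ) : ℤ) * U + 1 ∧
      (kit0 t D mk (((Mu D + 1 : ℕ) : ℤ) * U + 1) r₀).d + 2 ≤ Skelφ.shellD (kit0 t D mk (((Mu D + 1 : ℕ) : ℤ) * U + 1) r₀) ∧
      KS.Rs t D mk + 1 ≤ Skelφ.shellD (kit0 t D mk (((Mu D + 1 : ℕ) : ℤ) * U + 1) r₀) ∧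
      (Skelφ.shellD (kit0 t D mk (((Mu D + 1 : ℕ) : ℤ) * U + 1) r₀) + Mu D + 1) * (kq + 1) ≤ KS.KCmax t D mk ∧
      (Skelφ.shellD (kit0 t D mk (((Mu D + 1 : ℕ) : ℤ) * U + 1) r₀) : ℤ) + KS.KCmax t D mk + KS.Rs t D mk ≤
        tanOff (kit0 t D mk (((Mu D + 1 : ℕ) : ℤ) * U + 1) r₀).ℓs (kit0 t D mk (((Mu D + 1 : ℕ) : ℤ) * U + 1) r₀).M := by
  obtain ⟨hN, hd, hρ, hK, hT, -⟩ := kit0_ok t D mk (((Mu D + 1 : ℕ) : ℤ) * U + 1) r₀ (kq := kq) hkq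
  exact ⟨hN, rfl, hd, hρ, hK, hT⟩

end RunKit

section Levels

variable (κ : Consts) {V : Type} [DecidableEq V] [Countable V] {G : SimpleGraph V} [G.LocallyFinite] (Φ : PlanarSkeletonFrm G) (t : V) (p : unitInterval)
  (D : Skelφ.StepI.DataNS V) (mk : ℕ)

/-- **G8/G15 — the inner kits' LEVELS** (all three inner kits are the (S0) kit: `Rlev₁ = Rlev₂ = Rlev₃ := Rlev0`, `j₀ := j₀0`, `j₁ := j₁0`, `R's = R'₃ := R'0`):
`hRl : Rlev0 + 1 ≤ R'0` (equality), `hj : j₁0 ≤ Rlev0`, and `j₀0 ≤ j₁0` under `0 < p < 1`. [folklore] -/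
theorem levels_0 (hp0 : 0 < (p : ℝ)) (hp1 : (p : ℝ) < 1) :
    Rlev0 κ Φ t p D mk + 1 ≤ R'0 κ Φ t p D mk ∧ j₁0 κ Φ t p D mk ≤ Rlev0 κ Φ t p D mk ∧ j₀0 t D mk ≤ j₁0 κ Φ t p D mk :=
  ⟨le_of_eq (R'0_eq κ Φ t p D mk).2.1, (R'0_eq κ Φ t p D mk).2.2, j₀0_le_j₁0 κ Φ t p D mk hp0 hp1⟩

/-- **G15 — THE INNER KITS' COUNTS AT THE ROOT ACCURACY `κ.δr 0`** (`kk₁ = kk₂ = kk₃ := kk0`, `N₁ = N₂ = N₃' := Nk0`, `rsb = rsr := rs0`, `cSb = cSr := cS0`):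
`hkN : kk0·(Δ+1)^{2·rs0} ≤ Nk0`, `hk : (1 − q^{1+Δ·cS0+cS0·cU})^{kk0} ≤ δr 0`, `hcount : 1/(1−q)^{Δ·Nk0} ≤ δr 0 · card (Icc j₀0 j₁0)`. [folklore] -/
theorem counts_root_0 (hp0 : 0 < (p : ℝ)) (hp1 : (p : ℝ) < 1) {q : unitInterval} (hq1 : (p : ℝ) / 2 ≤ q) (hq2 : (q : ℝ) ≤ p) :
    kk0 κ Φ t p D mk * (Φ.Δ + 1) ^ (2 * rs0 t D mk) ≤ Nk0 κ Φ t p D mk ∧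
      (1 - (q : ℝ) ^ (1 + Φ.Δ * cS0 Φ t D mk + cS0 Φ t D mk * KS.cUA Φ t D mk)) ^ kk0 κ Φ t p D mk ≤ κ.δr 0 ∧
      1 / (1 - (q : ℝ)) ^ (Φ.Δ * Nk0 κ Φ t p D mk) ≤ κ.δr 0 * ((Finset.Icc (j₀0 t D mk) (j₁0 κ Φ t p D mk)).card : ℝ) :=
  ⟨hNk0_at κ Φ t p D mk hp0 hp1, counts_atq_root κ Φ t p D mk hp0 hp1 hq1 hq2⟩

/-- **G15 — the same counts at ANY accuracy `δ′ ≥ δkit`** (e.g. the keystone's `δ := Neg.δkit κ Φ`, N1's choice; `KS0.counts_atq`). [folklore] -/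
theorem counts_kit_0 (hp0 : 0 < (p : ℝ)) (hp1 : (p : ℝ) < 1) {q : unitInterval} (hq1 : (p : ℝ) / 2 ≤ q) (hq2 : (q : ℝ) ≤ p) {δ' : ℝ} (hδ' : Neg.δkit κ Φ ≤ δ') :
    kk0 κ Φ t p D mk * (Φ.Δ + 1) ^ (2 * rs0 t D mk) ≤ Nk0 κ Φ t p D mk ∧
      (1 - (q : ℝ) ^ (1 + Φ.Δ * cS0 Φ t D mk + cS0 Φ t D mk * KS.cUA Φ t D mk)) ^ kk0 κ Φ t p D mk ≤ δ' ∧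
      1 / (1 - (q : ℝ)) ^ (Φ.Δ * Nk0 κ Φ t p D mk) ≤ δ' * ((Finset.Icc (j₀0 t D mk) (j₁0 κ Φ t p D mk)).card : ℝ) :=
  ⟨hNk0_at κ Φ t p D mk hp0 hp1, counts_atq κ Φ t p D mk hp0 hp1 hq1 hq2 hδ'⟩

end Levels

section Region

variable {V : Type} {G : SimpleGraph V} [G.LocallyFinite] (Φ : PlanarSkeletonFrm G) (t : V) (D : Skelφ.StepI.DataNS V) (mk : ℕ) (ψ : V → Site 2)

/-- **G13 — the short region `Rg := KS.RgK G t D mk ψ`** in the keystone's shape: `hRg : ∀ c', ∀ u ∈ Rg c', u ∈ B(c', Rs)`, `hRgcard : ∀ c', |Rg c'| ≤ cU` (`cU := cUA`),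
`hcU1 : 1 ≤ cU` (KitS). [folklore] -/
theorem region_rows :
    (∀ c', ∀ u ∈ KS.RgK G t D mk ψ c', u ∈ graphBall G c' (KS.Rs t D mk)) ∧ (∀ c', (KS.RgK G t D mk ψ c').card ≤ KS.cUA Φ t D mk) ∧ 1 ≤ KS.cUA Φ t D mk :=
  ⟨fun c' => KS.RgK_subset_graphBall t D mk ψ c', fun c' => KS.card_RgK_le Φ t D mk ψ c', KS.hcU1_at Φ t D mk⟩

end Region

end KS0

end NegB

end PlanarSkeletonFrm

end Summit.CriticalPhenomena.PercolationContinuityZ3.Theorems.Transplant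

end
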